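import Summits.PneNP.PneNP.Theorems.ChebyshevTracialDesignAmplitudeOneOfAllDirections
import Summits.PneNP.PneNP.Theorems.ChebyshevTracialDesignPairContainmentMean
import HarnessLib

/-!
# Cell pnp-psdrank, route `ChebyshevTracialDesign`: THE PER-CUT REDUCTION — (CG_1′) for ALL masks at once, hence the whole amplitude-one rung of
# the crux, is EQUIVALENT to ONE mask-free statement: per-cut virtual nonpositivity of the pair-containment form in `M`-ADAPTED direction fields
# (crux `TracialDecayExp20`, stmt-PneNP-19878)

Brick 165 (prover g32; MEMO-34 §8 made exact, MEMO-35 §1). Notation: `x_p = 1[p ∈ U]`, `π_M` the partner map of a perfect matching `M`,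
`C_v(U) = C^M_v(U) := Σ_p v_p x_p x_{π_M p}` the pair-containment form, `W = levelWeight` (or ANY weight in §1), a DIRECTION FIELD is
`v : PMatch n → (Fin n → ℝ)` with `|v_M(p)| ≤ 1`, a MASK is `f : cuts → [0, G]`. The literal (CG_1′) for a mask `f` (MEMO-21 §3(c′); the tree's
format, e.g. brick 163d `junta_containment_allDirections_decay`) is «`Σ_M (Σ_U W(U,M) f(U) C_{v_M}(U)²)₊ ≤ ε'` for every field `v`», and by brick 150
(`…AmplitudeOneOfAllDirections.amplitudeOne_of_allDirections`) its `M`-summed form already yields the crux's bound on the amplitude class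
`𝒜₁(f) = {X_U = f(U)·B_UB_Uᵀ : deg B = 1, B_UB_Uᵀ ⪯ I}` at every dimension. The mask programme (bricks 113–163) proves it mask class by mask class.
THIS FILE: because `v_M` may be chosen independently for each `M`, quantifying over ALL masks `0 ≤ f ≤ G` turns (CG_1′) into a statement with NO MASK:
* §1 (design-free, any weight `W`) **`sum_posPart_perM_le_of_perCut`**: if (PC)_ε «`Σ_U (Σ_M W(U,M) C_{v_M}(U)²)₊ ≤ ε` for every field `|v| ≤ 1`»
  then `Σ_M (Σ_U W(U,M) f(U) C_{v_M}(U)²)₊ ≤ G·ε` for every mask `0 ≤ f ≤ G` and every field (truncate the field to `v'_M = v_M·1[Q_M ≥ 0]`, swap the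
  sums, bound `f` by `G` on the cuts with positive per-cut value); **`perCut_le_of_sum_posPart_perM`**: conversely (CG_1′)_{ε'} for all masks
  `0 ≤ f ≤ G` gives `G·Σ_U (Σ_M W(U,M) C_{v_M}(U)²)₊ ≤ ε'` (test the mask `f = G·1[per-cut value > 0]`). So for `G > 0`:
  (PC)_ε ⟺ (CG_1′)_{Gε} on the whole mask class `[0, G]` — «sup over fields of the `M`-sum = `Σ_M` sup».
* §2 **`perCut_containment_sq_nonpos_of_fixed`** / `perCut_posPart_eq_zero_of_fixed` — (PC) is EXACT (`≤ 0` at EVERY cut, `ε = 0`) for every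
  `M`-INDEPENDENT field (brick 105 `sum_containment_sq_eq_linear` at the mask `δ_{U₀}`: the per-cut value is `−(Σ_{p∈U₀} u_p)²/#t-cuts`); brick 164
  (`…PairContainmentLowDegreeFields.star_containment_sq_nonpos_at`, same session) extends exactness to every field reading `≤ D/2 − 1` local bits of
  `M` (pinned stars `1[S ⊆ M]·u`, window-local fields).
* §3 **`amplitudeOne_allMasks_of_perCut`** — THE REDUCTION OF THE RUNG: for an even `n ≥ 256` and a balanced exact design of the crux's shape,
  (PC)_ε implies, for EVERY mask `0 ≤ f ≤ G` (no structure), every degree-one factor `B_U = Σ_p x_p β_p` with `B_UB_Uᵀ ⪯ I` on the `t`-cuts and every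
  psd contraction field `Y` of any dimension `r`: `Σ_{U,M} W(U,M) f(U) tr(B_UB_UᵀY_M) ≤ 8·(G·ε + 60·G·n⁴·√P_{dq n−4})·r` (§1 + brick 150).
READING. The per-cut value `Σ_M W(U,M) C_{v_M}(U)² = (#t-cuts)⁻¹·Σ_c w_c·E_{M : cc(U,M) = c}[C_{v_M}(U)²]` is the design value, AT THE CUT `U`, of the
squared `v`-weight of the `M`-edges inside `U`; the adversary chooses one direction per matching and is charged the total positive per-cut value. The
open heart of the 𝒜₁ rung is therefore not a mask class but «per-cut virtual nonpositivity for `M`-ADAPTED fields»: fields adapted to a single cut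
(`v_M = x_{U₀}·1[cc(U₀,M) ∈ C₊]`, MEMO-34 §8(i)) make ONE cut positive at the admissible price `O(t²)/#t-cuts`; `M`-independent and `M`-local fields
make NO cut positive (§2, brick 164); what must be excluded is a field that is positive on an `ε`-fraction of the cuts simultaneously.
[cite: GriblingDelaatLaurent2019, §5] [cite: Rothvoss2017, §2 and Lemma 7 (PDF pp. 5–8)] [cite: Potechin2019, Thm. 1.2 (LIPIcs 124, 61:4)]
[cite: BrietDadushPokutta2014, Thm. 6 (§3)]
Stature: support/instrument (kernel lane, no defs, axioms standard; a REDUCTION and two exact instances — nothing is discharged for `M`-global fields).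
WHAT THIS IS NOT: not (PC) itself, no proof or refutation of `TracialDecayExp20`, nothing on psd rank of P_PM(K_n) beyond the rungs, no P-vs-NP
content. Supports stmt-PneNP-19878.
-/

set_option linter.dupNamespace false -- `Summit.PneNP.PneNP.…`: summit = sub-problem (D-0017)

noncomputable section

namespace Summit.PneNP.PneNP.Theorems.ChebyshevTracialDesignPerCutReduction

open Finset Matrix Literature.Barriers.PneNP Literature.Combinatorics.Optimization
open Summit.PneNP.PneNP.Theorems.ChebyshevTracialDesignAmplitudeOneOfAllDirections (amplitudeOne_of_allDirections)
open Summit.PneNP.PneNP.Theorems.ChebyshevTracialDesignPairContainmentMean (sum_containment_sq_eq_linear)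

variable {n : ℕ}

/-! ### §1 Design-free: positive parts per matching for all masks versus positive parts per cut -/

/-- **(PC) ⟹ (CG_1′) FOR EVERY MASK.** For ANY weight `W`: if every direction field `|v_M(p)| ≤ 1` has total positive PER-CUT value
`Σ_U (Σ_M W(U,M) C_{v_M}(U)²)₊ ≤ ε`, then for every mask `0 ≤ f ≤ G` and every field `|v| ≤ 1` the total positive PER-MATCHING value is
`Σ_M (Σ_U W(U,M) f(U) C_{v_M}(U)²)₊ ≤ G·ε`. (Truncate the field to the matchings with nonnegative value, swap the sums, bound `f ≤ G` where the
per-cut value is positive and `f ≥ 0` where it is not.) [cite: GriblingDelaatLaurent2019, §5] [cite: Rothvoss2017, §2 (PDF p. 6)] -/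
theorem sum_posPart_perM_le_of_perCut (W : OddSet n → PMatch n → ℝ) {G ε : ℝ} (hG : 0 ≤ G)
    (hPC : ∀ v : PMatch n → Fin n → ℝ, (∀ M p, |v M p| ≤ 1) →
      ∑ U : OddSet n, max (∑ M : PMatch n, W U M *
        (∑ p, v M p * ((if p ∈ U.1 then (1 : ℝ) else 0) * (if M.2.partner p ∈ U.1 then (1 : ℝ) else 0))) ^ 2) 0 ≤ ε)
    (f : OddSet n → ℝ) (hf0 : ∀ U, 0 ≤ f U) (hfG : ∀ U, f U ≤ G)
    (v : PMatch n → Fin n → ℝ) (hv : ∀ M p, |v M p| ≤ 1) :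
    ∑ M : PMatch n, max (∑ U : OddSet n, W U M *
        (f U * (∑ p, v M p * ((if p ∈ U.1 then (1 : ℝ) else 0) * (if M.2.partner p ∈ U.1 then (1 : ℝ) else 0))) ^ 2)) 0 ≤
      G * ε := by
  classical
  -- the per-matching values and the truncated field
  set Q : PMatch n → ℝ := fun M => ∑ U : OddSet n, W U M *
      (f U * (∑ p, v M p * ((if p ∈ U.1 then (1 : ℝ) else 0) * (if M.2.partner p ∈ U.1 then (1 : ℝ) else 0))) ^ 2) with hQ
  set v' : PMatch n → Fin n → ℝ := fun M p => if 0 ≤ Q M then v M p else 0 with hv'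
  have hv'1 : ∀ M p, |v' M p| ≤ 1 := fun M p => by
    simp only [hv']
    split_ifs
    · exact hv M p
    · simp
  have hC' : ∀ (M : PMatch n) (U : OddSet n),
      ∑ p, v' M p * ((if p ∈ U.1 then (1 : ℝ) else 0) * (if M.2.partner p ∈ U.1 then (1 : ℝ) else 0)) =
        (if 0 ≤ Q M then (1 : ℝ) else 0) *
          ∑ p, v M p * ((if p ∈ U.1 then (1 : ℝ) else 0) * (if M.2.partner p ∈ U.1 then (1 : ℝ) else 0)) := by
    intro M U
    rw [mul_sum]
    refine sum_congr rfl fun p _ => ?_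
    simp only [hv']
    split_ifs <;> ring
  -- per matching, the positive part is the value of the truncated field
  have hmax : ∀ M : PMatch n, max (Q M) 0 = ∑ U : OddSet n, W U M *
      (f U * (∑ p, v' M p * ((if p ∈ U.1 then (1 : ℝ) else 0) * (if M.2.partner p ∈ U.1 then (1 : ℝ) else 0))) ^ 2) := by
    intro M
    simp_rw [hC' M]
    by_cases hpos : 0 ≤ Q M
    · rw [max_eq_left hpos]
      simp only [hpos, if_true, one_mul]
      rfl
    · rw [max_eq_right (le_of_lt (lt_of_not_ge hpos))]
      simp only [hpos, if_false, zero_mul]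
      symm
      exact sum_eq_zero fun U _ => by ring
  -- the per-cut values of the truncated field
  set g : OddSet n → ℝ := fun U => ∑ M : PMatch n, W U M *
      (∑ p, v' M p * ((if p ∈ U.1 then (1 : ℝ) else 0) * (if M.2.partner p ∈ U.1 then (1 : ℝ) else 0))) ^ 2 with hg
  have hswap : ∑ M : PMatch n, ∑ U : OddSet n, W U M *
      (f U * (∑ p, v' M p * ((if p ∈ U.1 then (1 : ℝ) else 0) * (if M.2.partner p ∈ U.1 then (1 : ℝ) else 0))) ^ 2) =
      ∑ U : OddSet n, f U * g U := by
    rw [sum_comm]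
    refine sum_congr rfl fun U _ => ?_
    rw [hg, mul_sum]
    refine sum_congr rfl fun M _ => ?_
    ring
  have hPC' := hPC v' hv'1
  calc ∑ M : PMatch n, max (Q M) 0
      = ∑ U : OddSet n, f U * g U := by rw [← hswap]; exact sum_congr rfl fun M _ => hmax M
    _ ≤ ∑ U : OddSet n, G * max (g U) 0 := sum_le_sum fun U _ => by
        calc f U * g U ≤ f U * max (g U) 0 := mul_le_mul_of_nonneg_left (le_max_left _ _) (hf0 U)
          _ ≤ G * max (g U) 0 := mul_le_mul_of_nonneg_right (hfG U) (le_max_right _ _)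
    _ = G * ∑ U : OddSet n, max (g U) 0 := by rw [mul_sum]
    _ ≤ G * ε := mul_le_mul_of_nonneg_left hPC' hG

/-- **(CG_1′) FOR EVERY MASK ⟹ (PC).** For ANY weight `W` and `G`: if every mask `0 ≤ f ≤ G` and every field `|v| ≤ 1` have
`Σ_M (Σ_U W(U,M) f(U) C_{v_M}(U)²)₊ ≤ ε'`, then every field has `G·Σ_U (Σ_M W(U,M) C_{v_M}(U)²)₊ ≤ ε'` (test the mask
`f = G·1[per-cut value ≥ 0]`). With `sum_posPart_perM_le_of_perCut`: the two statements are EQUIVALENT on the mask class `[0, G]`.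
[cite: GriblingDelaatLaurent2019, §5] [cite: Rothvoss2017, §2 (PDF p. 6)] -/
theorem perCut_le_of_sum_posPart_perM (W : OddSet n → PMatch n → ℝ) {G ε' : ℝ} (hG : 0 ≤ G)
    (hCG : ∀ f : OddSet n → ℝ, (∀ U, 0 ≤ f U) → (∀ U, f U ≤ G) → ∀ v : PMatch n → Fin n → ℝ, (∀ M p, |v M p| ≤ 1) →
      ∑ M : PMatch n, max (∑ U : OddSet n, W U M *
        (f U * (∑ p, v M p * ((if p ∈ U.1 then (1 : ℝ) else 0) * (if M.2.partner p ∈ U.1 then (1 : ℝ) else 0))) ^ 2)) 0 ≤ ε')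
    (v : PMatch n → Fin n → ℝ) (hv : ∀ M p, |v M p| ≤ 1) :
    G * ∑ U : OddSet n, max (∑ M : PMatch n, W U M *
        (∑ p, v M p * ((if p ∈ U.1 then (1 : ℝ) else 0) * (if M.2.partner p ∈ U.1 then (1 : ℝ) else 0))) ^ 2) 0 ≤ ε' := by
  classical
  set g : OddSet n → ℝ := fun U => ∑ M : PMatch n, W U M *
      (∑ p, v M p * ((if p ∈ U.1 then (1 : ℝ) else 0) * (if M.2.partner p ∈ U.1 then (1 : ℝ) else 0))) ^ 2 with hg
  set f : OddSet n → ℝ := fun U => if 0 ≤ g U then G else 0 with hf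
  have hf0 : ∀ U, 0 ≤ f U := fun U => by simp only [hf]; split_ifs <;> [exact hG; exact le_rfl]
  have hfG : ∀ U, f U ≤ G := fun U => by simp only [hf]; split_ifs <;> [exact le_rfl; exact hG]
  have hfg : ∀ U, f U * g U = G * max (g U) 0 := fun U => by
    simp only [hf]
    by_cases h : 0 ≤ g U
    · rw [if_pos h, max_eq_left h]
    · rw [if_neg h, max_eq_right (le_of_lt (lt_of_not_ge h)), zero_mul, mul_zero]
  have hswap : ∑ M : PMatch n, ∑ U : OddSet n, W U M *
      (f U * (∑ p, v M p * ((if p ∈ U.1 then (1 : ℝ) else 0) * (if M.2.partner p ∈ U.1 then (1 : ℝ) else 0))) ^ 2) =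
      ∑ U : OddSet n, f U * g U := by
    rw [sum_comm]
    refine sum_congr rfl fun U _ => ?_
    rw [hg, mul_sum]
    refine sum_congr rfl fun M _ => ?_
    ring
  have key := hCG f hf0 hfG v hv
  calc G * ∑ U : OddSet n, max (g U) 0 = ∑ U : OddSet n, f U * g U := by
        rw [mul_sum]; exact sum_congr rfl fun U _ => (hfg U).symm
    _ = ∑ M : PMatch n, ∑ U : OddSet n, W U M *
          (f U * (∑ p, v M p * ((if p ∈ U.1 then (1 : ℝ) else 0) * (if M.2.partner p ∈ U.1 then (1 : ℝ) else 0))) ^ 2) :=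
        hswap.symm
    _ ≤ ∑ M : PMatch n, max (∑ U : OddSet n, W U M *
          (f U * (∑ p, v M p * ((if p ∈ U.1 then (1 : ℝ) else 0) * (if M.2.partner p ∈ U.1 then (1 : ℝ) else 0))) ^ 2)) 0 :=
        sum_le_sum fun M _ => le_max_left _ _
    _ ≤ ε' := key

/-! ### §2 The per-cut value is exactly nonpositive in every matching-independent direction -/

/-- **At EVERY cut, an `M`-INDEPENDENT direction has per-cut value `≤ 0`**: for an exact design of degree `D ≥ 2` on the `t`-cuts, every odd cut
`U₀` and every `u : Fin n → ℝ`, `Σ_M W(U₀,M)·(Σ_p u_p x_p(U₀) x_{π_M p}(U₀))² ≤ 0` (brick 105's identity at the mask `δ_{U₀}`: the value is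
`−(Σ_{p∈U₀} u_p)²/#t-cuts` on a `t`-cut and `0` otherwise). [cite: Rothvoss2017, §2 (PDF p. 6)] [cite: Grigoriev2001, Lemma 1.4 (PDF p. 8)] -/
theorem perCut_containment_sq_nonpos_of_fixed {t T D : ℕ} {Bv : ℝ} {C : Finset ℕ} {w : ℕ → ℝ}
    (hdes : IsExactDesign n t T D Bv C w) (hD : 2 ≤ D) (U₀ : OddSet n) (u : Fin n → ℝ) :
    ∑ M : PMatch n, levelWeight n t C w U₀ M *
      (∑ p, u p * ((if p ∈ U₀.1 then (1 : ℝ) else 0) * (if M.2.partner p ∈ U₀.1 then (1 : ℝ) else 0))) ^ 2 ≤ 0 := by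
  classical
  have h := sum_containment_sq_eq_linear hdes hD (fun U => if U = U₀ then (1 : ℝ) else 0) u
  have hL : ∑ U : OddSet n, ∑ M : PMatch n, levelWeight n t C w U M *
      ((if U = U₀ then (1 : ℝ) else 0) *
        (∑ p, u p * ((if p ∈ U.1 then (1 : ℝ) else 0) * (if M.2.partner p ∈ U.1 then (1 : ℝ) else 0))) ^ 2) =
      ∑ M : PMatch n, levelWeight n t C w U₀ M *
        (∑ p, u p * ((if p ∈ U₀.1 then (1 : ℝ) else 0) * (if M.2.partner p ∈ U₀.1 then (1 : ℝ) else 0))) ^ 2 := by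
    rw [Finset.sum_eq_single U₀ (fun U _ hU => sum_eq_zero fun M _ => by rw [if_neg hU]; ring)
      (fun hU => absurd (mem_univ _) hU)]
    exact sum_congr rfl fun M _ => by rw [if_pos rfl, one_mul]
  rw [hL] at h
  rw [h, neg_div]
  refine neg_nonpos.2 (div_nonneg (sum_nonneg fun U _ => ?_) (Nat.cast_nonneg _))
  split_ifs
  · exact mul_nonneg zero_le_one (sq_nonneg _)
  · rw [zero_mul]

/-- Hence (PC) holds with `ε = 0` for every `M`-independent field: the total positive per-cut value VANISHES.
[cite: Rothvoss2017, §2 (PDF p. 6)] [cite: Grigoriev2001, Lemma 1.4 (PDF p. 8)] -/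
theorem perCut_posPart_eq_zero_of_fixed {t T D : ℕ} {Bv : ℝ} {C : Finset ℕ} {w : ℕ → ℝ}
    (hdes : IsExactDesign n t T D Bv C w) (hD : 2 ≤ D) (u : Fin n → ℝ) :
    ∑ U : OddSet n, max (∑ M : PMatch n, levelWeight n t C w U M *
      (∑ p, u p * ((if p ∈ U.1 then (1 : ℝ) else 0) * (if M.2.partner p ∈ U.1 then (1 : ℝ) else 0))) ^ 2) 0 = 0 :=
  sum_eq_zero fun U _ => max_eq_right (perCut_containment_sq_nonpos_of_fixed hdes hD U u)

/-! ### §3 The amplitude-one rung for ALL masks from the per-cut statement -/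

/-- **THE 𝒜₁ RUNG FOR EVERY MASK REDUCES TO (PC).** Let `n ≥ 256` be even and `(t, C, w)` a balanced exact design of the crux's shape
(`IsBalancedDesign n t (Tq n) (dq n) 20 C w`). Suppose (PC)_ε: every direction field `|v_M(p)| ≤ 1` has total positive per-cut value
`Σ_U (Σ_M W(U,M) C_{v_M}(U)²)₊ ≤ ε`. Then for EVERY mask `0 ≤ f ≤ G` (no structure assumed), every degree-one factor `B_U = Σ_p x_p β_p` with
`B_UB_Uᵀ ⪯ I` on the `t`-cuts and every psd contraction field `Y` of any dimension `r`:
`Σ_{U,M} W(U,M)·f(U)·tr(B_UB_UᵀY_M) ≤ 8·(G·ε + 60·G·n⁴·√P_{dq n−4})·r` (§1 feeds brick 150 `amplitudeOne_of_allDirections`).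
[cite: GriblingDelaatLaurent2019, §5] [cite: Rothvoss2017, §2 and Lemma 7 (PDF pp. 5–8)] [cite: BrietDadushPokutta2014, Thm. 6 (§3)] -/
theorem amplitudeOne_allMasks_of_perCut {t : ℕ} {C : Finset ℕ} {w : ℕ → ℝ} (hev : Even n) (hn256 : 256 ≤ n)
    (hdes : IsBalancedDesign n t (Tq n) (dq n) 20 C w) {ε : ℝ}
    (hPC : ∀ v : PMatch n → Fin n → ℝ, (∀ M p, |v M p| ≤ 1) →
      ∑ U : OddSet n, max (∑ M : PMatch n, levelWeight n t C w U M *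
        (∑ p, v M p * ((if p ∈ U.1 then (1 : ℝ) else 0) * (if M.2.partner p ∈ U.1 then (1 : ℝ) else 0))) ^ 2) 0 ≤ ε)
    (f : Finset (Fin n) → ℝ) {G : ℝ} (hG0 : 0 ≤ G) (hf0 : ∀ U, 0 ≤ f U) (hfG : ∀ U, f U ≤ G)
    {r m : ℕ} (β : Fin n → Matrix (Fin r) (Fin m) ℝ)
    (hB : ∀ U : OddSet n, U.1.card = t →
      (1 - (∑ p, (if p ∈ U.1 then (1 : ℝ) else 0) • β p) * (∑ p, (if p ∈ U.1 then (1 : ℝ) else 0) • β p)ᵀ).PosSemidef)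
    (Y : PMatch n → Matrix (Fin r) (Fin r) ℝ) (hY : ∀ M, (Y M).PosSemidef ∧ (1 - Y M).PosSemidef) :
    ∑ U : OddSet n, ∑ M : PMatch n, levelWeight n t C w U M *
        (f U.1 *
          ((∑ p, (if p ∈ U.1 then (1 : ℝ) else 0) • β p) * (∑ p, (if p ∈ U.1 then (1 : ℝ) else 0) • β p)ᵀ * Y M).trace) ≤
      8 * (G * ε + 60 * G * (n : ℝ) ^ 4 *
        Real.sqrt (∏ i ∈ range ((dq n - 4) / 2 + 1), ((2 * i + 1 : ℝ) / ((n : ℝ) - 2 * i)))) * r := by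
  classical
  have hall : ∀ c : PMatch n → Fin n → ℝ, (∀ M p, |c M p| ≤ 1) → (∀ M p, c M (M.2.partner p) = c M p) →
      ∑ M : PMatch n, ∑ U : OddSet n, levelWeight n t C w U M * (f U.1 *
        (∑ p : Fin n, c M p * ((if p ∈ U.1 then (1 : ℝ) else 0) * (if M.2.partner p ∈ U.1 then (1 : ℝ) else 0))) ^ 2) ≤ 1 * G * ε := by
    intro c hc _
    have h1 := sum_posPart_perM_le_of_perCut (levelWeight n t C w) hG0 hPC (fun U => f U.1) (fun U => hf0 U.1) (fun U => hfG U.1) c hc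
    rw [one_mul]
    exact le_trans (sum_le_sum fun M _ => le_max_left _ _) h1
  have h150 := amplitudeOne_of_allDirections hev hn256 hdes f hG0 hf0 hfG hall β hB Y hY
  simpa only [one_mul] using h150

end Summit.PneNP.PneNP.Theorems.ChebyshevTracialDesignPerCutReduction
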